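import Literature.Claims.NS.ClayVariants
import Literature.Analysis.FluidPDE.ClassicalSolution
import Mathlib.LinearAlgebra.CrossProduct
import HarnessLib

/-!
# Claims/NS — Aksman 2026, «Global Regularity Without Uniqueness: The Vorton-Filament Solution of the 3D
Incompressible Navier-Stokes Problem» (C175, D-0090 NS-CLAIMS SWEEP)

TEXT OF RECORD: Zenodo record 21263950 (doi 10.5281/zenodo.21263950; concept 21263949, SINGLE version,
created 2026-07-08), PDF sha16 4dc47ee78d4116b9, 7 pp., PDF page = printed page (census pin
`census/texts/Aksman2026/`); bib `Aksman2026`. Printed author line p.1 l.6–8. Setting: «the three-dimensional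
incompressible Navier-Stokes equations» (abstract p.1 l.10) — the NSE are never displayed; the evolved object is
the VORTON system: Definition 1 p.2 l.27–38 (1) the vorton vorticity `Ω^(α) = γ δ(x − r) + (3 r̂ (r̂·γ) − γ)/(4π|x − r|³)`,
its Biot–Savart velocity (2) p.2 l.40–49 `v^(α)(x) = γ^(α) × (x − r^(α)) / (4π |x − r^(α)|³)`, the induction
dynamics (3)–(4) p.3 l.2–27 `ṙ^(α) = Σ_{β≠α} v^(β)(r^(α))`, `γ̇^(α) = Σ_{β≠α} (γ^(α)·∇) v^(β)(r^(α))`, the filament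
superposition (5) p.3 l.28–37 `ω(x,t) = Σ_α Ω^(α)(x; r^(α)(t), γ^(α)(t))`, and the identification sentence
p.3 l.38–39 «By the Density Theorem (Section 4), vorton fields are complete in the solenoidal Hilbert space.
This is an exact representation of the vorticity, not a modeling ansatz.» Viscosity `ν` appears in no display
(CARD §3 Δ2).

CLAIMED STATEMENT = Theorem 11 p.6 l.18–22 «(Global regularity without uniqueness). For arbitrary smooth
divergence-free initial data u0: (i) The solution set is a finite branch tree T(u0) whose vertices are vortex
reconnections. (ii) Every branch is globally smooth, satisfying the Beale-Kato-Majda criterion with uniform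
bound Kmax. (iii) Along each branch the solution is unique; all non-uniqueness is carried by the finitely many
topological rejoinings at the vertices. (iv) A globally smooth solution exists for u0, satisfying the exact
Millennium Prize formulation.» FACES: `ClaimedTheorem` = face (iv) in the print's own words «the exact
Millennium Prize formulation» = Fefferman (A) at every viscosity, typed over the tree's Clay vocabulary
(`ClayVariants.clayR3.RegularityAt`; data class (4) — Δ4 RECORDED: the print says «arbitrary smooth
divergence-free»; the no-decay face is `ClaimedTheoremWide`, RECORDED); face (ii) = `ClaimedBKM` RECORDED
(uniform gradient bound along the solution); faces (i)/(iii) = `ClaimedBranching` RECORDED (non-uniqueness of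
smooth solutions from smooth data; hazard h3: not consumed, not keyed).

PRINTED CHAIN (Thm 11 proof p.6 l.23–27): «By Corollary 2, regularity equals a positive spacing floor.
Theorem 7 (The Drift Bound) with Theorem 4 secures ρN ≥ ρmin > 0, simultaneously flooring the core (σ = a).
Theorem 5 caps intensity, halting blow-up. Theorem 8 limits vertices to E(0)/δ0. The uniform gradient bound
holds branchwise (Section 9), satisfying BKM. Consequently, the tree is finite, piecewise deterministic, and
globally smooth.» — every sentence is about the finite vorton system; it reaches the Navier–Stokes solution
only through the representation (5) + p.3 l.38–39 (the BRIDGE) and through «satisfying BKM» (ref. 9).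

TYPING NOTES. (1) All objects are CONCRETE: `vortonVel` = (2), `superpos` = the velocity of (5) (finite sum
over `Fin N`; «fixed N» p.6 l.5), `IsVortonTrajectoryOn` = (3)–(4) (the stretching term `(γ·∇)v^(β)(r^(α))`
= `fderiv ℝ v^(β) (r^(α)) γ^(α)`), `SpacedBy ρ` = «ρ_N ≥ ρ» (minimal pairwise vorton spacing, p.4 l.6–7,
l.34–36). Junk values recorded: at a pole `x = r` the field (2) is `0` in Lean (`1/0 = 0`); a.e. statements
are unaffected. (2) THE BRIDGE is typed in two conjuncts as the chair ruled (v1.50 (1)): `Step_repr_exact`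
(p.3 l.38–39 + (5) + abstract l.13–14 «not approximated by, but is»: every datum of the class IS, a.e., a finite
superposition of vorton velocity fields with distinct poles) and `Step_repr_dyn` (p.3 l.2 «The vortons evolve
by mutual advection and stretching» + l.38–39 + p.6 l.25: the Navier–Stokes flow from `u0` IS the evolved
superposition — a classical solution, a.e. equal to it at every time, with its gradient bound). Theorem 3
(Density, p.4 l.9–16) is typed verbatim at its own grain (`Step_T3_density`, `L²(Ω)` density of the span of
the fields (2) in the solenoidal space `H(Ω)` of a bounded open `Ω`, distance in `[0, ∞]` so that non-`L²`
combinations are at distance `⊤`) and enters the FINE composition through the printed inference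
`Step_T3_bridge : Step_T3_density → Step_repr_exact` («complete … exact representation», p.3 l.38–39);
LOCATORS v2 §3 records that each `v^(α)` is not in `L²` near its pole. (3) Cor 2 / Thm 4 / Thm 7 / Thm 5 / (12)
are typed AS PRINTED for the vorton system: `Step_C2` (a trajectory of (3)–(4) from every configuration, global
or ending at a finite time before which the spacing has no positive floor — «blow-up is reconnection» p.4
l.4–7), `Step_T47` («Theorem 7 with Theorem 4 secures ρN ≥ ρmin > 0» along every trajectory, p.6 l.23–24;
Thm 4 (iii) p.4 l.35–36, Thm 7 (10) p.5 l.12–16), `Step_T5` ((8) p.4 l.39–46 «|γi(t)| ≤ … ≡ Γmax» along every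
trajectory), `Step_12` ((12) p.6 l.4–11 «With the spacing floor ρmin, intensity cap Γmax, and fixed N, the
velocity gradient is uniformly bounded: ‖∇u‖_{L∞} ≤ C0 N Γmax/σ²min ≡ Kmax», typed for the represented
velocity `u = superpos` with `σmin :=` the spacing floor, as the proof's «flooring the core (σ = a)» l.24
identifies them; h2 recorded: a single vorton's gradient is unbounded at its pole). (4) `Step_BKM` = «satisfying
BKM. Consequently … globally smooth» + (iv): a global classical solution from a Clay datum with uniformly bounded
gradient is a Clay (A) solution (ref. 9 BKM 1984; TRUE-type candidate modulo the tree's (7)/`t = 0` packaging).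
(5) Thm 8 (11) / Thm 9 / Thm 10 (reconnection count, branch tree) bear on faces (i)/(iii) only; with
`Step_T47`'s floor no collision occurs along the typed chain, so they are RECORDED by locator, not typed.
(6) Compositions PROVED: `claim_of_steps` (binders IN PRINTED ORDER `Step_repr_exact`, `Step_C2`, `Step_T47`,
`Step_T5`, `Step_12`, `Step_repr_dyn`, `Step_BKM` — all consumed) and `claim_of_steps_fine` (Thm 3 +
`Step_T3_bridge` in place of `Step_repr_exact`). CLAY: `clayA_of_claimed : ClaimedTheorem → clayR3.Regularity`
is definitional (the print claims (A) in words); Δ1 (domain mixed/none), Δ2 (equations), Δ4 (data), Δ5 (no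
pressure/energy clause), Δ7 (parameters) RECORDED in CARD §3.

WHAT THIS IS NOT: not a claim about NS regularity or blow-up; not a claim about any author beyond the typed locator.
-/

noncomputable section

open Set Function Filter MeasureTheory Metric
open scoped Topology ENNReal NNReal ContDiff InnerProductSpace RealInnerProductSpace Matrix

namespace Literature.Claims.NS.Aksman2026

open Literature.Analysis.FluidPDE

/-- Physical space `ℝ³`. [cite: Aksman2026, Def. 1 p.2 l.27–38] -/
abbrev E3 : Type := EuclideanSpace ℝ (Fin 3)

/-! ### §2 p.2–3 — vortons: (2), (3)–(4), (5) -/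

/-- The cross product on `ℝ³` (Mathlib's `crossProduct` transported to `EuclideanSpace`). [folklore] -/
def cross (a b : E3) : E3 :=
  (EuclideanSpace.equiv (Fin 3) ℝ).symm
    (crossProduct (EuclideanSpace.equiv (Fin 3) ℝ a) (EuclideanSpace.equiv (Fin 3) ℝ b))

/-- **The vorton velocity field (2)** p.2 l.40–49: `v^(α)(x) = γ^(α) × (x − r^(α)) / (4π |x − r^(α)|³)`
(Biot–Savart of the dipole (1)); value `0` at the pole (Lean junk, a null set).
[cite: Aksman2026, (2) p.2 l.40–49] -/
def vortonVel (r γ : E3) (x : E3) : E3 :=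
  (1 / (4 * Real.pi * ‖x - r‖ ^ 3)) • cross γ (x - r)

/-- **The filament superposition (5) at velocity level** p.3 l.28–37 (with (2)): `u(x) = Σ_α v^(α)(x)` for
`N` vortons at positions `R α` with intensities `Γ α` («fixed N», p.6 l.5). [cite: Aksman2026, (5) p.3 l.28–37] -/
def superpos {N : ℕ} (R Γ : Fin N → E3) (x : E3) : E3 :=
  ∑ α, vortonVel (R α) (Γ α) x

/-- «ρ_N ≥ ρ»: every two distinct vortons are at distance at least `ρ` (the minimal transverse spacing of
Cor 2 p.4 l.6–7, Thm 4 p.4 l.34–36). [cite: Aksman2026, Cor. 2 p.4 l.4–7; Thm 4 p.4 l.30–36] -/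
def SpacedBy {N : ℕ} (ρ : ℝ) (R : Fin N → E3) : Prop :=
  ∀ α β : Fin N, α ≠ β → ρ ≤ ‖R α - R β‖

/-- **The vorton dynamics (3)–(4)** p.3 l.2–27 on a time set `S`: `ṙ^(α) = Σ_{β≠α} v^(β)(r^(α))` and
`γ̇^(α) = Σ_{β≠α} (γ^(α)·∇) v^(β)(r^(α))` (directional derivative = `fderiv`), derivatives within `S`.
[cite: Aksman2026, (3)–(4) p.3 l.2–27] -/
def IsVortonTrajectoryOn {N : ℕ} (S : Set ℝ) (R Γ : ℝ → Fin N → E3) : Prop :=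
  ∀ α : Fin N, ∀ t ∈ S,
    HasDerivWithinAt (fun s => R s α)
      (∑ β ∈ Finset.univ.erase α, vortonVel (R t β) (Γ t β) (R t α)) S t ∧
    HasDerivWithinAt (fun s => Γ s α)
      (∑ β ∈ Finset.univ.erase α, fderiv ℝ (vortonVel (R t β) (Γ t β)) (R t α) (Γ t α)) S t

/-! ### The claimed statement (Theorem 11 p.6 l.18–22) -/

/-- **Theorem 11 (iv)** p.6 l.21–22 «A globally smooth solution exists for u0, satisfying the exact Millennium
Prize formulation» — Fefferman (A) at every viscosity `ν > 0` for data of the Clay class (4) (the print: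
«arbitrary smooth divergence-free initial data»; Δ4 recorded, wider face `ClaimedTheoremWide`).
[claim: Aksman2026, status: disputed] [cite: Aksman2026, Thm 11 (iv) p.6 l.18–22; abstract p.1 l.10–12, l.27] -/
def ClaimedTheorem : Prop :=
  ∀ ν : ℝ, 0 < ν → ∀ u₀ : E3 → E3, ContDiff ℝ ∞ u₀ → NSWave0.IsDivFree u₀ → HasRapidSpatialDecay u₀ →
    ClayVariants.clayR3.Solvable ν 0 u₀

/-- **Theorem 11 (iv), wide face** («arbitrary smooth divergence-free initial data», no decay class): a global
classical solution from `u0`. RECORDED (not consumed; no energy/pressure clause is printed — Δ5).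
[claim: Aksman2026, status: disputed] [cite: Aksman2026, Thm 11 p.6 l.18–22] -/
def ClaimedTheoremWide : Prop :=
  ∀ ν : ℝ, 0 < ν → ∀ u₀ : E3 → E3, ContDiff ℝ ∞ u₀ → VectorCalculus.IsDivFree u₀ →
    ∃ (U : ℝ → E3 → E3) (P : ℝ → E3 → ℝ), IsClassicalNSSolutionOn (Ici 0) ν 0 U P ∧ U 0 = u₀

/-- **Theorem 11 (ii)** p.6 l.19–20 «Every branch is globally smooth, satisfying the Beale-Kato-Majda criterion
with uniform bound Kmax» ((12) p.6 l.4–11): a global classical solution from `u0` whose velocity gradient is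
uniformly bounded. RECORDED face. [claim: Aksman2026, status: disputed] [cite: Aksman2026, Thm 11 (ii) p.6 l.19–20; (12) p.6 l.4–14] -/
def ClaimedBKM : Prop :=
  ∀ ν : ℝ, 0 < ν → ∀ u₀ : E3 → E3, ContDiff ℝ ∞ u₀ → NSWave0.IsDivFree u₀ → HasRapidSpatialDecay u₀ →
    ∃ (U : ℝ → E3 → E3) (P : ℝ → E3 → ℝ), IsClassicalNSSolutionOn (Ici 0) ν 0 U P ∧ U 0 = u₀ ∧
      ∃ K : ℝ, ∀ t : ℝ, 0 ≤ t → ∀ x : E3, ‖fderiv ℝ (U t) x‖ ≤ K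

/-- **Theorem 11 (i)/(iii)** p.6 l.18–21 (abstract l.11–12 «these solutions are not unique: the flow branches at
vortex reconnection»): there is a smooth divergence-free datum of the class carrying two classical solutions on a
common slab `[0, T)` that differ at some time. RECORDED face (hazard h3; not consumed, not keyed).
[claim: Aksman2026, status: disputed] [cite: Aksman2026, Thm 11 (i),(iii) p.6 l.18–21; §1 p.2 l.13–22] -/
def ClaimedBranching : Prop :=
  ∃ (ν : ℝ) (u₀ : E3 → E3) (T : ℝ) (U V : ℝ → E3 → E3) (P Q : ℝ → E3 → ℝ),
    0 < ν ∧ 0 < T ∧ ContDiff ℝ ∞ u₀ ∧ NSWave0.IsDivFree u₀ ∧ HasRapidSpatialDecay u₀ ∧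
      IsClassicalNSSolutionOn (Ico 0 T) ν 0 U P ∧ IsClassicalNSSolutionOn (Ico 0 T) ν 0 V Q ∧
      U 0 = u₀ ∧ V 0 = u₀ ∧ ∃ t ∈ Ico 0 T, U t ≠ V t

/-! ### The bridge — p.3 l.38–39 with (5), and Theorem 3 p.4 -/

/-- **The representation, first conjunct (EXACTNESS)** — p.3 l.38–39 «This is an exact representation of the
vorticity, not a modeling ansatz» with (5) p.3 l.31–37 and the abstract p.1 l.13–14 «The vorticity field is not
approximated by, but is, a superposition of singular vorton dipoles», AS USED for «arbitrary smooth
divergence-free initial data» (Thm 11): every datum of the class is, almost everywhere, the velocity (2)/(5) of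
finitely many vortons at distinct positions. CONSUMED binder 1. [claim: Aksman2026, status: disputed]
[cite: Aksman2026, p.3 l.38–39; (5) p.3 l.28–37; abstract p.1 l.13–14] -/
def Step_repr_exact : Prop :=
  ∀ u₀ : E3 → E3, ContDiff ℝ ∞ u₀ → NSWave0.IsDivFree u₀ → HasRapidSpatialDecay u₀ →
    ∃ (N : ℕ) (R Γ : Fin N → E3), Function.Injective R ∧ ∀ᵐ x : E3, u₀ x = superpos R Γ x

/-- The solenoidal space `H(Ω) = {u ∈ L²(Ω; ℝ³) : ∇·u = 0, u·n|∂Ω = 0}` of Thm 3 p.4 l.12–16, in weak form: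
square-integrable on `Ω` and orthogonal on `Ω` to every smooth gradient. [cite: Aksman2026, Thm 3 p.4 l.12–16] -/
def InH (Ω : Set E3) (φ : E3 → E3) : Prop :=
  MemLp φ 2 (volume.restrict Ω) ∧
    ∀ θ : E3 → ℝ, ContDiff ℝ ∞ θ → ∫ x in Ω, ⟪φ x, gradient θ x⟫ = 0

/-- **Theorem 3 (Density)** p.4 l.9–16 «The linear span of vorton velocity fields v^(α) = ∇ × (γ^(α) G(x − r^(α))),
where G(x) = −1/(4π|x|), is dense in H = {u ∈ L²(Ω; R³) : ∇ · u = 0, u · n|∂Ω = 0}» (Ω «a bounded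
domain», l.27–28), verbatim: every element of `H(Ω)` is an `L²(Ω)`-limit of finite superpositions (5) (distance
in `[0, ∞]`). Binder of the FINE composition. [claim: Aksman2026, status: disputed] [cite: Aksman2026, Thm 3 p.4 l.9–28] -/
def Step_T3_density : Prop :=
  ∀ Ω : Set E3, IsOpen Ω → Bornology.IsBounded Ω → Ω.Nonempty →
    ∀ φ : E3 → E3, InH Ω φ → ∀ ε : ℝ, 0 < ε →
      ∃ (N : ℕ) (R Γ : Fin N → E3),
        eLpNorm (fun x => φ x - superpos R Γ x) 2 (volume.restrict Ω) < ENNReal.ofReal ε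

/-- **«complete … This is an exact representation»** p.3 l.38–39 — the printed inference from Theorem 3
(density) to the exactness used by (5): typed as the implication it asserts. Binder of the FINE composition.
[claim: Aksman2026, status: disputed] [cite: Aksman2026, p.3 l.38–39] -/
def Step_T3_bridge : Prop := Step_T3_density → Step_repr_exact

/-! ### Cor 2 p.4, Thm 4 + Thm 7, Thm 5, (12) p.6 — the vorton-system chain of Thm 11's proof -/

/-- **Corollary 2 (Blow-up is reconnection)** p.4 l.4–7 with (3)–(4): from every configuration with distinct
positions the vorton dynamics has a trajectory which is either global on `[0, ∞)` or lives on a maximal `[0, T*)`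
before which the transverse spacing has no positive floor («a finite-time singularity can only be a transverse
collision … ρN → 0»). CONSUMED binder 2. [claim: Aksman2026, status: disputed] [cite: Aksman2026, Cor. 2 p.4 l.4–7; (3)–(4) p.3] -/
def Step_C2 : Prop :=
  ∀ (N : ℕ) (R₀ Γ₀ : Fin N → E3), Function.Injective R₀ →
    ∃ R Γ : ℝ → Fin N → E3, R 0 = R₀ ∧ Γ 0 = Γ₀ ∧
      (IsVortonTrajectoryOn (Ici 0) R Γ ∨
        ∃ Ts : ℝ, 0 < Ts ∧ IsVortonTrajectoryOn (Ico 0 Ts) R Γ ∧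
          ∀ ρ : ℝ, 0 < ρ → ∃ t ∈ Ico 0 Ts, ¬ SpacedBy ρ (R t))

/-- **«Theorem 7 (The Drift Bound) with Theorem 4 secures ρN ≥ ρmin > 0»** (Thm 11 proof p.6 l.23–24; Thm 4
(iii) p.4 l.35–36 «uniform spacing floor ρN ≥ D exp(−S0/[N(N − 1)]) > 0», Thm 7 (10) p.5 l.12–29): along every
trajectory of (3)–(4) starting from distinct positions the spacing keeps a positive floor. CONSUMED binder 3.
[claim: Aksman2026, status: disputed] [cite: Aksman2026, Thm 11 proof p.6 l.23–24; Thm 4 p.4 l.30–38; Thm 7 p.5 l.12–29] -/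
def Step_T47 : Prop :=
  ∀ (N : ℕ) (S : Set ℝ) (R Γ : ℝ → Fin N → E3), 0 ∈ S → Function.Injective (R 0) →
    IsVortonTrajectoryOn S R Γ → ∃ ρ : ℝ, 0 < ρ ∧ ∀ t ∈ S, SpacedBy ρ (R t)

/-- **Theorem 5 (Circulation cap)** (8) p.4 l.39–46 «|γi(t)| ≤ E(0)σi/cΓ ≤ E(0)D/cΓ ≡ Γmax» for all time,
along every trajectory (constants after the configuration). CONSUMED binder 4. [claim: Aksman2026, status: disputed]
[cite: Aksman2026, Thm 5 (8) p.4 l.39–50] -/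
def Step_T5 : Prop :=
  ∀ (N : ℕ) (S : Set ℝ) (R Γ : ℝ → Fin N → E3), 0 ∈ S → IsVortonTrajectoryOn S R Γ →
    ∃ Γmax : ℝ, ∀ t ∈ S, ∀ α : Fin N, ‖Γ t α‖ ≤ Γmax

/-- **(12)** p.6 l.4–11 «With the spacing floor ρmin, intensity cap Γmax, and fixed N, the velocity gradient is
uniformly bounded: ‖∇u‖_{L∞} ≤ C0 N Γmax/σ²min ≡ Kmax < ∞» — for the represented velocity `u = Σ_α v^(α)`
((5)/(2)), with `σmin` = the spacing floor («flooring the core (σ = a)», p.6 l.24). CONSUMED binder 5.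
[claim: Aksman2026, status: disputed] [cite: Aksman2026, (12) p.6 l.2–11; Thm 1 p.3 l.41–44] -/
def Step_12 : Prop :=
  ∃ C₀ : ℝ, 0 < C₀ ∧ ∀ (N : ℕ) (R Γ : Fin N → E3) (ρ Γmax : ℝ), 0 < ρ → SpacedBy ρ R →
    (∀ α : Fin N, ‖Γ α‖ ≤ Γmax) → ∀ x : E3, ‖fderiv ℝ (superpos R Γ) x‖ ≤ C₀ * N * Γmax / ρ ^ 2

/-- **The representation, second conjunct (DYNAMICS)** — p.3 l.2 «The vortons evolve by mutual advection and
stretching of their intensities» (3)–(4) with p.3 l.38–39 and p.6 l.25 «The uniform gradient bound holds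
branchwise», AS USED: for a datum of the class represented exactly at `t = 0`, the Navier–Stokes flow from it IS
the evolved superposition — a global classical solution `(U, P)`, a.e. equal to `Σ_α v^(α)(·; r^(α)(t), γ^(α)(t))`
at every `t ≥ 0`, carrying the representation's uniform gradient bound. CONSUMED binder 6.
[claim: Aksman2026, status: disputed] [cite: Aksman2026, (3)–(4) p.3 l.2–27; p.3 l.38–39; Thm 11 proof p.6 l.25] -/
def Step_repr_dyn : Prop :=
  ∀ ν : ℝ, 0 < ν → ∀ u₀ : E3 → E3, ContDiff ℝ ∞ u₀ → NSWave0.IsDivFree u₀ → HasRapidSpatialDecay u₀ →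
    ∀ (N : ℕ) (R Γ : ℝ → Fin N → E3) (K : ℝ), IsVortonTrajectoryOn (Ici 0) R Γ →
      (∀ᵐ x : E3, u₀ x = superpos (R 0) (Γ 0) x) →
      (∀ t : ℝ, 0 ≤ t → ∀ x : E3, ‖fderiv ℝ (superpos (R t) (Γ t)) x‖ ≤ K) →
        ∃ (U : ℝ → E3 → E3) (P : ℝ → E3 → ℝ), IsClassicalNSSolutionOn (Ici 0) ν 0 U P ∧ U 0 = u₀ ∧
          (∀ t : ℝ, 0 ≤ t → ∀ᵐ x : E3, U t x = superpos (R t) (Γ t) x) ∧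
          ∀ t : ℝ, 0 ≤ t → ∀ x : E3, ‖fderiv ℝ (U t) x‖ ≤ K

/-- **«satisfying BKM. Consequently, the tree is … globally smooth»** (Thm 11 proof p.6 l.25–27; §9 p.6 l.12–16
«The Beale-Kato-Majda criterion ∫₀ᵀ ‖ω‖_{L∞} dt < ∞ is satisfied uniformly branchwise»; ref. 9) with (iv): a
global classical solution from a Clay datum whose gradient is uniformly bounded is a solution «satisfying the
exact Millennium Prize formulation». CONSUMED binder 7 (TRUE-type candidate modulo the (7)/`t = 0` packaging).
[claim: Aksman2026, status: disputed] [cite: Aksman2026, Thm 11 proof p.6 l.25–27; §9 p.6 l.12–16] -/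
def Step_BKM : Prop :=
  ∀ ν : ℝ, 0 < ν → ∀ u₀ : E3 → E3, ContDiff ℝ ∞ u₀ → NSWave0.IsDivFree u₀ → HasRapidSpatialDecay u₀ →
    (∃ (U : ℝ → E3 → E3) (P : ℝ → E3 → ℝ), IsClassicalNSSolutionOn (Ici 0) ν 0 U P ∧ U 0 = u₀ ∧
        ∃ K : ℝ, ∀ t : ℝ, 0 ≤ t → ∀ x : E3, ‖fderiv ℝ (U t) x‖ ≤ K) →
      ClayVariants.clayR3.Solvable ν 0 u₀

/-! ### Records: Thm 8 (11) p.5 l.31–41, Thm 9, Thm 10 p.5 l.42–46 (reconnection quantum, piecewise determinism,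
finiteness of the tree) bear on faces (i)/(iii) (`ClaimedBranching`); along the typed chain `Step_T47` excludes
collisions, so no reconnection vertex is reached — recorded by locator, not typed. -/

/-! ### Kernel compositions (the paper's own implications; PROVED) -/

/-- A trajectory on `[0, T*)` with a positive spacing floor contradicts the collision clause of `Step_C2`, so under
`Step_T47` the trajectory is global. [cite: Aksman2026, Thm 11 proof p.6 l.23–24] -/
theorem global_trajectory (hC2 : Step_C2) (h47 : Step_T47) {N : ℕ} {R₀ Γ₀ : Fin N → E3}
    (hinj : Function.Injective R₀) :
    ∃ R Γ : ℝ → Fin N → E3, R 0 = R₀ ∧ Γ 0 = Γ₀ ∧ IsVortonTrajectoryOn (Ici 0) R Γ := by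
  obtain ⟨R, Γ, hR0, hΓ0, hglob | ⟨Ts, hTs, htraj, hcoll⟩⟩ := hC2 N R₀ Γ₀ hinj
  · exact ⟨R, Γ, hR0, hΓ0, hglob⟩
  · exfalso
    have hinj' : Function.Injective (R 0) := by rw [hR0]; exact hinj
    obtain ⟨ρ, hρ, hfloor⟩ := h47 N (Ico 0 Ts) R Γ ⟨le_rfl, hTs⟩ hinj' htraj
    obtain ⟨t, ht, hnot⟩ := hcoll ρ hρ
    exact hnot (hfloor t ht)

/-- **Theorem 11 (iv) from the printed chain** (proof p.6 l.23–27): exact representation ⇒ global vorton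
trajectory (Cor 2 + Thm 4/7) with capped intensities (Thm 5) ⇒ uniform gradient bound (12) ⇒ the flow is the
evolved representation (p.3) ⇒ BKM ⇒ the Millennium solution. Every binder consumed, in printed order.
[cite: Aksman2026, Thm 11 proof p.6 l.23–27] -/
theorem claim_of_steps (hex : Step_repr_exact) (hC2 : Step_C2) (h47 : Step_T47) (hT5 : Step_T5)
    (h12 : Step_12) (hdyn : Step_repr_dyn) (hBKM : Step_BKM) : ClaimedTheorem := by
  intro ν hν u₀ hu₀ hdiv hdec
  obtain ⟨N, R₀, Γ₀, hinj, hrep⟩ := hex u₀ hu₀ hdiv hdec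
  obtain ⟨R, Γ, hR0, hΓ0, htraj⟩ := global_trajectory hC2 h47 hinj
  have hinj' : Function.Injective (R 0) := by rw [hR0]; exact hinj
  obtain ⟨ρ, hρ, hfloor⟩ := h47 N (Ici 0) R Γ (mem_Ici.2 le_rfl) hinj' htraj
  obtain ⟨Γmax, hcap⟩ := hT5 N (Ici 0) R Γ (mem_Ici.2 le_rfl) htraj
  obtain ⟨C₀, hC₀, hgrad⟩ := h12
  set K : ℝ := C₀ * N * Γmax / ρ ^ 2 with hK
  have hKt : ∀ t : ℝ, 0 ≤ t → ∀ x : E3, ‖fderiv ℝ (superpos (R t) (Γ t)) x‖ ≤ K :=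
    fun t ht x => hgrad N (R t) (Γ t) ρ Γmax hρ (hfloor t (mem_Ici.2 ht)) (hcap t (mem_Ici.2 ht)) x
  have hrep0 : ∀ᵐ x : E3, u₀ x = superpos (R 0) (Γ 0) x := by rw [hR0, hΓ0]; exact hrep
  obtain ⟨U, P, hcl, hU0, -, hUK⟩ := hdyn ν hν u₀ hu₀ hdiv hdec N R Γ K htraj hrep0 hKt
  exact hBKM ν hν u₀ hu₀ hdiv hdec ⟨U, P, hcl, hU0, K, hUK⟩

/-- **The fine composition through Theorem 3**: density + the printed «complete ⇒ exact» inference in place of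
`Step_repr_exact`. [cite: Aksman2026, Thm 3 p.4 l.9–28; p.3 l.38–39] -/
theorem claim_of_steps_fine (hT3 : Step_T3_density) (hbr : Step_T3_bridge) (hC2 : Step_C2) (h47 : Step_T47)
    (hT5 : Step_T5) (h12 : Step_12) (hdyn : Step_repr_dyn) (hBKM : Step_BKM) : ClaimedTheorem :=
  claim_of_steps (hbr hT3) hC2 h47 hT5 h12 hdyn hBKM

/-- The recorded face (ii) from the same chain (without the last BKM packaging). [cite: Aksman2026, Thm 11 (ii) p.6 l.19–20] -/
theorem claimedBKM_of_steps (hex : Step_repr_exact) (hC2 : Step_C2) (h47 : Step_T47) (hT5 : Step_T5)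
    (h12 : Step_12) (hdyn : Step_repr_dyn) : ClaimedBKM := by
  intro ν hν u₀ hu₀ hdiv hdec
  obtain ⟨N, R₀, Γ₀, hinj, hrep⟩ := hex u₀ hu₀ hdiv hdec
  obtain ⟨R, Γ, hR0, hΓ0, htraj⟩ := global_trajectory hC2 h47 hinj
  have hinj' : Function.Injective (R 0) := by rw [hR0]; exact hinj
  obtain ⟨ρ, hρ, hfloor⟩ := h47 N (Ici 0) R Γ (mem_Ici.2 le_rfl) hinj' htraj
  obtain ⟨Γmax, hcap⟩ := hT5 N (Ici 0) R Γ (mem_Ici.2 le_rfl) htraj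
  obtain ⟨C₀, hC₀, hgrad⟩ := h12
  have hKt : ∀ t : ℝ, 0 ≤ t → ∀ x : E3, ‖fderiv ℝ (superpos (R t) (Γ t)) x‖ ≤ C₀ * N * Γmax / ρ ^ 2 :=
    fun t ht x => hgrad N (R t) (Γ t) ρ Γmax hρ (hfloor t (mem_Ici.2 ht)) (hcap t (mem_Ici.2 ht)) x
  have hrep0 : ∀ᵐ x : E3, u₀ x = superpos (R 0) (Γ 0) x := by rw [hR0, hΓ0]; exact hrep
  obtain ⟨U, P, hcl, hU0, -, hUK⟩ := hdyn ν hν u₀ hu₀ hdiv hdec N R Γ _ htraj hrep0 hKt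
  exact ⟨U, P, hcl, hU0, _, hUK⟩

/-! ### Clay (A) link — definitional -/

/-- **The claim's face (iv) IS Fefferman (A) at every viscosity** (the print's words «the exact Millennium Prize
formulation»). [cite: FeffermanClay2006, (A) p. 2] [cite: Aksman2026, Thm 11 (iv) p.6 l.21–22] -/
theorem claimedTheorem_iff_clayA : ClaimedTheorem ↔ ClayVariants.clayR3.Regularity := Iff.rfl

/-- **Fefferman (A) from the claim.** [cite: FeffermanClay2006, (A) p. 2] [cite: Aksman2026, Thm 11 (iv) p.6 l.21–22] -/
theorem clayA_of_claimed (h : ClaimedTheorem) : ClayVariants.clayR3.Regularity :=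
  claimedTheorem_iff_clayA.1 h

/-- **Fefferman (A) from the printed chain.** [cite: FeffermanClay2006, (A) p. 2] [cite: Aksman2026, Thm 11 proof p.6 l.23–27] -/
theorem clayA_of_steps (hex : Step_repr_exact) (hC2 : Step_C2) (h47 : Step_T47) (hT5 : Step_T5)
    (h12 : Step_12) (hdyn : Step_repr_dyn) (hBKM : Step_BKM) : ClayVariants.clayR3.Regularity :=
  clayA_of_claimed (claim_of_steps hex hC2 h47 hT5 h12 hdyn hBKM)

end Literature.Claims.NS.Aksman2026

end

-- WHAT THIS IS NOT: not a claim about NS regularity or blow-up; not a claim about any author beyond the typed locator.
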